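import Literature.Computability.Cryptography.ChenQuantumLWESteps
import Mathlib.Data.Nat.GCD.Basic

/-!
# The product structure of `|φ8.f⟩` (Chen 2024, eq. (40)) — statements and kernel-decided toy certificates

REPRODUCTION / ANALYSIS OF A CLAIMED RESULT UNDER ADJUDICATION (withdrawn): Yilei Chen, *Quantum
Algorithms for Lattice Problems*, IACR ePrint 2024/555, version of 2024-04-18 [ChenQuantumLattice2024];
see the header of `ChenQuantumLWESteps.lean` for the author's withdrawal notes.  Companion of the
bundle file `STEPS.md` §4.3–4.4 (`papers/QuantumAdvantage/lwe-quantum-autopsy/`, Part 1).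
HONEST FRAMING: typed STATEMENTS plus kernel-decided toy CERTIFICATES about a withdrawn algorithm — a
precise negative result, NOT summit progress, no cryptanalytic claim.  The general proofs are in
`ChenQuantumLWEProductProofs.lean`.

Setting (C.3, p. 18; eq. (39)–(40), p. 36): `P = p₁·Q` with `gcd(p₁,Q)=1` (`Q = p₂⋯p_κ`), `N = D²P = M/2`.
After Step 8 and the CRT-slot swap (9.c), Chen's state is the CHIRPED LINE
`|φ8.f⟩ = Σ_{j ∈ ℤ_P} e(-j²/P) |2D²j·b* + (0|v*) mod N⟩` with `b*₀ = Q`, `p₁ ∣ b*ᵢ (i ≥ 1)`.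

* `ChirpedLine`, `ChirpedLine.ket` — such states, with phase exponents kept EXACT in `ZMod P`
  (amplitude `e(θ/P)`), so that structural facts are decidable; `phi8fLine` is eq. (40), `phi8bLine` the
  pre-swap state of p. 35.  (`Shape.phi8f` of `ChenQuantumLWESteps` is the same state indexed by
  `j ∈ [0,P)` as printed; the two are identified in `ChenQuantumLWEProductProofs`.)
* `Certificate L p₁ Q` — a CRT factorisation certificate: coordinate `0` reads `j mod p₁` only,
  coordinates `1..n` read `j mod Q` only, and `θ(j) = θ₁(j mod p₁) + θ₂(j mod Q)`.  `instA_certificate`,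
  `instD_certificate` are KERNEL-DECIDED instances for two toy parameter sets (`STEPS.md` §4.5).
* `CertificateGivesProduct` (statement): a certificate makes the ket a PRODUCT state
  (coordinate 0) ⊗ (coordinates 1..n).  `LocalMapsPreserveProduct` (statement): linear maps on the
  first factor keep product states product.  `GaussSumModulus` (statement): `|Σ_x e((ax²+bx)/m)|² = m`
  for odd `m`, unit `a`.  All three are PROVED in `ChenQuantumLWEProductProofs` for every parameter.
  Consequences (`STEPS.md` §4.4): no processing of coordinate 0 alone can produce the displayed,
  correlated `|φ8.i⟩`; after the final QFT, `u[1..n]` is exactly uniform and independent of `u₀`;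
  eq. (41) holds with probability `1/Q`, not `1`.
* `chirpCancelExponent`, `instA_step8_residue_insufficient` (kernel-decided): the kickback that would
  cancel the chirp of `|φ8.b⟩` is a function of `v′₀ mod N`; two offsets agreeing modulo `D²p₁` (all
  that Step 8 reveals, Lemma 3.13) require DIFFERENT kickbacks — the precise sense of "Step 9 needs
  `v′₀ mod M/2`, Step 8 gives `v′₀ mod D²p₁`" (`STEPS.md` §4.3; Chen p. 22 "imagine if we can learn one
  coordinate of `v′`").
-/

namespace Literature.Computability.Cryptography.Chen2024

open scoped BigOperators

/-- A chirped line state on `n+1` registers `ℤ_N`: `Σ_{j ∈ ℤ_P} e(θ j / P) |pt j⟩` — the common shape of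
Chen's `|φ8.b⟩` (p. 35) and `|φ8.f⟩` (eq. (40)). [cite: ChenQuantumLattice2024, eq. (40) p. 36] -/
structure ChirpedLine (n : ℕ) where
  /-- the period of the line parameter `j` (phase denominator) -/
  P : ℕ+
  /-- the register modulus -/
  N : ℕ+
  /-- the basis vector carried by parameter `j` -/
  pt : ZMod P → Fin (n + 1) → ZMod N
  /-- the phase exponent: amplitude `e((θ j).val / P)` -/
  θ : ZMod P → ZMod P

namespace ChirpedLine

variable {n : ℕ} (L : ChirpedLine n)

/-- The (unnormalised) ket of a chirped line. [cite: ChenQuantumLattice2024, eq. (40) p. 36] -/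
noncomputable def ket : (Fin (n + 1) → ZMod L.N) → ℂ :=
  fun z => ∑ j : ZMod L.P, if z = L.pt j then e (((L.θ j).val : ℚ) / L.P) else 0

end ChirpedLine

/-- Chen's `|φ8.f⟩` (eq. (40), p. 36) for shape `(D, p₁, Q)` and the vectors `b*`, `v*` of eq. (39)
(`v*₀` already subtracted, i.e. `vstar 0 = 0` in the paper): `pt j = 2D²j·b* + v* mod N`, `θ j = -j²`
(`e(-(2Dj)²/(2M)) = e(-j²/P)`). [cite: ChenQuantumLattice2024, eq. (39)–(40) p. 36] -/
def phi8fLine (n : ℕ) (D p₁ Q : ℕ+) (bstar vstar : Fin (n + 1) → ℤ) : ChirpedLine n where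
  P := p₁ * Q
  N := D * D * (p₁ * Q)
  pt := fun j i =>
    ((2 * (D : ℤ) ^ 2 * (j.val : ℤ) * bstar i + vstar i : ℤ) : ZMod (D * D * (p₁ * Q) : ℕ+))
  θ := fun j => -(j ^ 2)

/-- Chen's `|φ8.b⟩` (p. 35): the same chirped line BEFORE the swap, `pt j = 2D²j·b + v′ mod N` with the
offset `v′` UNKNOWN in every coordinate. [cite: ChenQuantumLattice2024, §3.5.9 p. 35] -/
def phi8bLine (n : ℕ) (D p₁ Q : ℕ+) (b v' : Fin (n + 1) → ℤ) : ChirpedLine n :=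
  phi8fLine n D p₁ Q b v'

/-- CRT factorisation certificate of a chirped line w.r.t. a coprime splitting `P = p₁·Q`: coordinate `0`
is a function of `j mod p₁`, coordinates `1..n` of `j mod Q`, and the phase exponent splits additively
(this bundle's reading of eq. (39)–(40): `b*₀ = Q` kills `j mod Q` in coordinate 0, `p₁ ∣ b*ᵢ` kills
`j mod p₁` elsewhere).  All fields are decidable data, so instances can be checked by `decide`.
[cite: ChenQuantumLattice2024, eq. (39)–(40) p. 36] -/
structure Certificate {n : ℕ} (L : ChirpedLine n) (p₁ Q : ℕ) where
  /-- the splitting of the period -/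
  hP : (L.P : ℕ) = p₁ * Q
  /-- the two factors are coprime -/
  cop : Nat.Coprime p₁ Q
  /-- coordinate 0 as a function of the residue `j mod p₁` -/
  A : ℕ → ZMod L.N
  /-- coordinates 1..n as a function of the residue `j mod Q` -/
  B : ℕ → Fin n → ZMod L.N
  /-- phase exponent (in `ZMod P`) as a function of `j mod p₁` -/
  θ₁ : ℕ → ZMod L.P
  /-- phase exponent (in `ZMod P`) as a function of `j mod Q` -/
  θ₂ : ℕ → ZMod L.P
  /-- coordinate 0 reads `j mod p₁` -/
  head : ∀ j : ZMod L.P, L.pt j 0 = A (j.val % p₁)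
  /-- coordinates 1..n read `j mod Q` -/
  tail : ∀ j : ZMod L.P, (fun t => L.pt j (Fin.succ t)) = B (j.val % Q)
  /-- the chirp splits -/
  phase : ∀ j : ZMod L.P, L.θ j = θ₁ (j.val % p₁) + θ₂ (j.val % Q)

/-- Product state across a bipartition `α × β` (unnormalised amplitudes). [folklore] -/
def IsProduct {α β : Type*} (ψ : α × β → ℂ) : Prop :=
  ∃ (a : α → ℂ) (b : β → ℂ), ∀ x y, ψ (x, y) = a x * b y

/-- View an `(n+1)`-register state as a bipartite state (coordinate 0, rest). [folklore] -/
def splitFirst {n N : ℕ} (ψ : (Fin (n + 1) → ZMod N) → ℂ) : ZMod N × (Fin n → ZMod N) → ℂ :=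
  fun z => ψ (Fin.cons z.1 z.2)

/-- STATEMENT (`STEPS.md` §4.4(a)): a certified chirped line is a product state `|A⟩ ⊗ |B⟩` across
coordinate 0 and the rest.  Proved as `certificateGivesProduct_holds` (`ChenQuantumLWEProductProofs`).
[cite: ChenQuantumLattice2024, eq. (40) p. 36 and the author's note p. 37] -/
def CertificateGivesProduct {n : ℕ} (L : ChirpedLine n) (p₁ Q : ℕ) : Prop :=
  Nonempty (Certificate L p₁ Q) → IsProduct (splitFirst L.ket)

/-- STATEMENT (§4.4(b), the no-go for every "repair" acting on coordinate 0 alone): a linear map applied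
to the first tensor factor keeps product states product.  (Measurements with classical control act
branchwise by such maps.)  Here for a finite index type, maps given by kernels `K`.  Proved as
`localMapsPreserveProduct_holds`. [folklore] -/
def LocalMapsPreserveProduct (α α' β : Type) [Fintype α] : Prop :=
  ∀ (K : α' → α → ℂ) (ψ : α × β → ℂ), IsProduct ψ →
    IsProduct (fun z : α' × β => ∑ x : α, K z.1 x * ψ (x, z.2))

/-- STATEMENT (§4.4(c), classical quadratic Gauss sum, Korobov 1992 Ch. I §3 Thm 3 / eq. (41)): for odd
`m` and a unit `a`, `|Σ_{x ∈ ℤ_m} e((a x² + b x)/m)|² = m`.  Applied to the `|B⟩` factor of `|φ8.f⟩`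
(leading coefficient `-βp₁`, a unit mod `Q`; `Q` odd) it gives: the QFT outcome `u[1..n]` is EXACTLY
uniform, whatever was done to coordinate 0.  Proved as `gaussSumModulus_holds`.
[cite: Korobov1992, Ch. I §3 Thm 3, eq. (41)] -/
def GaussSumModulus (m : ℕ) [NeZero m] (a b : ZMod m) : Prop :=
  Odd m → IsUnit a → ‖∑ x : ZMod m, e (((a * x ^ 2 + b * x).val : ℚ) / m)‖ ^ 2 = m

/-! ### Kernel-decided certificates for the toy instances of `STEPS.md` §4.5 -/

/-- Instance A (`STEPS.md` §4.5 row 1): `p₁ = 3`, `Q = p₂ = 5`, `D = 1`, `n+1 = 4`, `b = (-1,30,6,12)`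
(secret `s = (1,2)`), `v′ = (4,7,9,2)`; eq. (39) gives `b* = (5,9,6,12)`, `v* = (7,4,9,2)`, and after
subtracting `v*₀`: `|φ8.f⟩ = Σ_{j∈ℤ₁₅} e(-j²/15) |(10j, 3j+4, 12j+9, 9j+2) mod 15⟩`.
[cite: ChenQuantumLattice2024, eq. (39)–(40) p. 36] -/
def instA : ChirpedLine 3 := phi8fLine 3 1 3 5 ![5, 9, 6, 12] ![0, 4, 9, 2]

/-- The CRT certificate of instance A: coordinate 0 = `10·(j mod 3)`, rest driven by `j mod 5`,
`-j² ≡ -10·(j mod 3)² + 9·(j mod 5)² (mod 15)` (`α = 2`, `β = -3`, `5α + 3β = 1`).  Decided by the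
kernel. [cite: ChenQuantumLattice2024, eq. (39)–(40) p. 36] -/
def instA_certificate : Certificate instA 3 5 where
  hP := by decide
  cop := by decide
  A := fun j₁ => 10 * (j₁ : ZMod instA.N)
  B := fun j₂ => ![3 * (j₂ : ZMod instA.N) + 4, 12 * (j₂ : ZMod instA.N) + 9, 9 * (j₂ : ZMod instA.N) + 2]
  θ₁ := fun j₁ => -(10 * (j₁ : ZMod instA.P) ^ 2)
  θ₂ := fun j₂ => 9 * (j₂ : ZMod instA.P) ^ 2
  head := by decide
  tail := by decide
  phase := by decide

/-- Instance D (`STEPS.md` §4.5 row 6, `κ = 3`): `p₁ = 3`, `(p₂,p₃) = (5,7)`, `Q = 35`, `D = 1`, `n+1 = 5`,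
`b = (-1,30,42,6,12)`, `v′ = (1,2,3,4,5)`; eq. (39): `b* = (35,9,27,6,12)`, `v* = (52,86,78,4,5)`; after
subtracting `v*₀`: `pt j = (70j, 18j+86, 54j+78, 12j+4, 24j+5) mod 105`, `θ j = -j²`.
[cite: ChenQuantumLattice2024, eq. (39)–(40) p. 36] -/
def instD : ChirpedLine 4 := phi8fLine 4 1 3 35 ![35, 9, 27, 6, 12] ![0, 86, 78, 4, 5]

set_option maxRecDepth 20000 in
/-- The CRT certificate of instance D (`α = 2`, `β = -23`, `35α + 3β = 1`).  Decided by the kernel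
(`maxRecDepth` raised for `decide` over `ZMod 105`). [cite: ChenQuantumLattice2024, eq. (39)–(40) p. 36] -/
def instD_certificate : Certificate instD 3 35 where
  hP := by decide
  cop := by decide
  A := fun j₁ => 70 * (j₁ : ZMod instD.N)
  B := fun j₂ => ![18 * (j₂ : ZMod instD.N) + 86, 54 * (j₂ : ZMod instD.N) + 78,
                  12 * (j₂ : ZMod instD.N) + 4, 24 * (j₂ : ZMod instD.N) + 5]
  θ₁ := fun j₁ => -(70 * (j₁ : ZMod instD.P) ^ 2)
  θ₂ := fun j₂ => 69 * (j₂ : ZMod instD.P) ^ 2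
  head := by decide
  tail := by decide
  phase := by decide

/-! ### What Step 9 requires versus what Step 8 delivers (`STEPS.md` §4.3) -/

/-- The exponent (in `ZMod P`, amplitude `e(·/P)`) of the kickback that cancels the chirp of
`|φ8.b⟩ = Σ_j e(-j²/P)|2D²j·b + v′ mod N⟩` as a function of the REGISTER content `z₀` of coordinate 0
(`b₀ = -1`): `j ≡ (v′₀ - z₀)/(2D²) (mod P)`, so the needed phase is `e(+((v′₀ - z₀)·(2D²)⁻¹)²/P)` — a
function of `v′₀ mod N` (indeed of `v′₀ mod P` after reduction).  `inv2D2` is `(2D²)⁻¹ mod P`.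
[cite: ChenQuantumLattice2024, §3.5 p. 22 and §3.5.9 p. 35] -/
def chirpCancelExponent (P N : ℕ+) (inv2D2 : ZMod P) (v0 : ZMod N) (z0 : ZMod N) : ZMod P :=
  (((v0 - z0).val : ZMod P) * inv2D2) ^ 2

/-- Instance A (`D = 1`, `p₁ = 3`, `P = N = 15`, `(2D²)⁻¹ = 8 mod 15`): the offsets `v′₀ = 4` and
`v′₀ = 7` agree modulo `D²p₁ = 3` — Step 8 (Lemma 3.13) cannot tell them apart — yet the
chirp-cancelling kickbacks they require are different functions of the register.  Kernel-decided.
[cite: ChenQuantumLattice2024, Lemma 3.13 p. 32 and §3.5.9 p. 35] -/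
theorem instA_step8_residue_insufficient :
    ((4 : ℤ) : ZMod 3) = ((7 : ℤ) : ZMod 3) ∧
    chirpCancelExponent 15 15 8 4 ≠ chirpCancelExponent 15 15 8 7 := by
  refine ⟨by decide, ?_⟩
  intro h
  have := congrFun h 4
  revert this
  decide

end Literature.Computability.Cryptography.Chen2024
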